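import Mathlib
import HarnessLib
import Summits.HubbardSuperconductivity.HubbardSuperconductivity.Theorems.KLProgrammeKLRegimeEngineV8DefsU10

/-!
# K3 ENGINE coupling doors below the frame-slope thresholds `1/(R.Gfr j + 1)` (plan g19 (R58)(b): p3 g10's W1 OWN DOOR
# `U ≤ min (klEngU₀3 P R cc) (1/(R.Gfr 3 + 1))` of `anisoTorusSumWt_flow` IS derivable from the registered binder `U ≤ klEngU₀10 P R c`)

Cell `gate-hubbard-kl`, seat hubbard-kl-k3c2-p1 g6 (the k3c2-p1 lineage owns the `klEngU₀*` door chain …DefsU4/…/DefsU10 and the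
v2 successor `klEngU₀11`).

QUESTION OF RECORD (KL STATUS 2026-08-27 l.3394 (R58)(b)): p3's W1 supply `TorusFourierL2.anisoTorusSumWt_flow` (p553005) binds
`0 < U ≤ min (klEngU₀3 P R cc) (1/(R.Gfr 3 + 1))`; whoever consumes it under stub (b)'s registered binder `U ≤ klEngU₀10 P R c` (v2:
`klEngU₀11 ≤ klEngU₀10`) needs `klEngU₀10 P R c ≤ 1/(R.Gfr 3 + 1)` — «derivable or not?».  ANSWER: DERIVABLE, in the chain's own
currency, with nothing but `R.WF` (signs `0 ≤ R.Gfr j`, which `R.WF2` carries): the v4 door `klEngU₀4 P R c = 2^{-128}/(Psq⁴·Rsq⁴·(c²+1))`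
(…DefsU4) sits below `1/(2·klEngRsq R)`, and `klEngRsq R = 1 + cr² + cz² + Σ_{j<5} Gfr_j²` dominates `(|Gfr_j| + 1)/2` for every
`j < 5` and ANY sign (`2g² − g + 1 > 0`).  Hence, with no new door row anywhere:

* `abs_gfr_add_one_le_two_mul_klEngRsq` — `|R.Gfr j| + 1 ≤ 2·klEngRsq R` (`j < 5`, sign-free);
* `klEngU₀4_le_inv_two_mul_klEngRsq` — `klEngU₀4 P R c ≤ 1/(2·klEngRsq R)`;
* `klEngU₀4_le_inv_abs_gfr_add_one` — `klEngU₀4 P R c ≤ 1/(|R.Gfr j| + 1)` (`j < 5`, sign-free), `klEngU₀4_le_inv_gfr_add_one` (`R.WF`);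
* the riders `klEngU₀9_le_inv_gfr_add_one`, **`klEngU₀10_le_inv_gfr_add_one`** (`j < 5`), **`klEngU₀10_le_inv_gfr3_add_one`**;
* the consumer line in p3's displayed shape: **`le_min_klEngU₀3_inv_gfr3_of_le_klEngU₀10`** —
  `R.WF → U ≤ klEngU₀10 P R c → U ≤ min (klEngU₀3 P R c) (1/(R.Gfr 3 + 1))`.

So DefsU11 needs NO `⊓ (1/(R.Gfr 3 + 1))` row: `klEngU₀11 ≤ klEngU₀10` rides this file.  One-line algebra on closed real terms;
nothing about the model is asserted; nothing asserts superconductivity.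
-/

noncomputable section

namespace Summit.HubbardSuperconductivity.HubbardSuperconductivity.Theorems.EngineV8

set_option linter.dupNamespace false -- summit = problem name (single-conjunct summit), D-0017

open Real Finset Literature.MathematicalPhysics.QuantumLattice Literature.Probability.LatticeModels
open Summit.HubbardSuperconductivity.HubbardSuperconductivity.Theorems.KLRegimeSplit

/-! ## §1 `klEngRsq` dominates every frame slope -/

/-- **`|R.Gfr j| + 1 ≤ 2·klEngRsq R`** for every `j < 5` and any sign of `R.Gfr j`: `klEngRsq R ≥ 1 + Gfr_j²` and `2(1 + g²) ≥ |g| + 1`. -/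
theorem abs_gfr_add_one_le_two_mul_klEngRsq (R : RenConsts) {j : ℕ} (hj : j < 5) : |R.Gfr j| + 1 ≤ 2 * klEngRsq R := by
  have h2 : R.Gfr j ^ 2 ≤ ∑ i ∈ range 5, R.Gfr i ^ 2 :=
    single_le_sum (f := fun i => R.Gfr i ^ 2) (fun i _ => sq_nonneg (R.Gfr i)) (mem_range.2 hj)
  have h3 : 1 + R.Gfr j ^ 2 ≤ klEngRsq R := by
    unfold klEngRsq; nlinarith [sq_nonneg R.cr, sq_nonneg R.cz]
  have h4 : |R.Gfr j| + 1 ≤ 2 * (1 + R.Gfr j ^ 2) := by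
    have habs : |R.Gfr j| ^ 2 = R.Gfr j ^ 2 := sq_abs _
    nlinarith [sq_nonneg (|R.Gfr j| - 1 / 4), abs_nonneg (R.Gfr j)]
  linarith

/-- `R.Gfr j + 1 ≤ 2·klEngRsq R` (`j < 5`, any sign). -/
theorem gfr_add_one_le_two_mul_klEngRsq (R : RenConsts) {j : ℕ} (hj : j < 5) : R.Gfr j + 1 ≤ 2 * klEngRsq R := by
  have h1 := le_abs_self (R.Gfr j)
  have h2 := abs_gfr_add_one_le_two_mul_klEngRsq R hj
  linarith

/-! ## §2 The v4 door below `1/(2·klEngRsq R)` and below every `1/(|R.Gfr j| + 1)` -/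

/-- **`klEngU₀4 P R c ≤ 1/(2·klEngRsq R)`**: `2·Rsq ≤ 2^{128}·Psq⁴·Rsq⁴·(c²+1)` since `Psq, Rsq ≥ 1`. -/
theorem klEngU₀4_le_inv_two_mul_klEngRsq (P : SplitConsts) (R : RenConsts) (c : ℝ) : klEngU₀4 P R c ≤ 1 / (2 * klEngRsq R) := by
  unfold klEngU₀4
  have hP1 : 1 ≤ klEngPsq P := one_le_klEngPsq P
  have hR1 : 1 ≤ klEngRsq R := one_le_klEngRsq R
  have hr := klEngRsq_pos R
  refine one_div_le_one_div_of_le (by positivity) ?_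
  have hP4 : (1 : ℝ) ≤ klEngPsq P ^ 4 := one_le_pow₀ hP1
  have hR4 : klEngRsq R ≤ klEngRsq R ^ 4 := by
    calc klEngRsq R = klEngRsq R ^ 1 := (pow_one _).symm
      _ ≤ klEngRsq R ^ 4 := pow_le_pow_right₀ hR1 (by norm_num)
  have hc : (1 : ℝ) ≤ c ^ 2 + 1 := by nlinarith [sq_nonneg c]
  calc 2 * klEngRsq R = 2 * 1 * klEngRsq R * 1 := by ring
    _ ≤ (2 : ℝ) ^ 128 * klEngPsq P ^ 4 * klEngRsq R ^ 4 * (c ^ 2 + 1) := by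
        apply mul_le_mul _ hc zero_le_one (by positivity)
        exact mul_le_mul (mul_le_mul (by norm_num) hP4 zero_le_one (by positivity)) hR4 hr.le (by positivity)

/-- **`klEngU₀4 P R c ≤ 1/(|R.Gfr j| + 1)`** for every `j < 5`, with NO sign hypothesis. -/
theorem klEngU₀4_le_inv_abs_gfr_add_one (P : SplitConsts) (R : RenConsts) (c : ℝ) {j : ℕ} (hj : j < 5) :
    klEngU₀4 P R c ≤ 1 / (|R.Gfr j| + 1) :=
  (klEngU₀4_le_inv_two_mul_klEngRsq P R c).trans
    (one_div_le_one_div_of_le (by positivity) (abs_gfr_add_one_le_two_mul_klEngRsq R hj))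

/-- **`klEngU₀4 P R c ≤ 1/(R.Gfr j + 1)`** for every `j < 5` under `R.WF` (`0 ≤ R.Gfr j`). -/
theorem klEngU₀4_le_inv_gfr_add_one (P : SplitConsts) {R : RenConsts} (hR : R.WF) (c : ℝ) {j : ℕ} (hj : j < 5) :
    klEngU₀4 P R c ≤ 1 / (R.Gfr j + 1) := by
  have h := klEngU₀4_le_inv_abs_gfr_add_one P R c hj
  rwa [abs_of_nonneg (hR.2.2 j)] at h

/-! ## §3 Riders: the v1 door `klEngU₀9` and the v2 door `klEngU₀10` -/

/-- `klEngU₀9 P R cc ≤ 1/(R.Gfr j + 1)` (`R.WF`, `j < 5`). -/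
theorem klEngU₀9_le_inv_gfr_add_one (P : SplitConsts) {R : RenConsts} (hR : R.WF) (cc : ℝ) {j : ℕ} (hj : j < 5) :
    klEngU₀9 P R cc ≤ 1 / (R.Gfr j + 1) :=
  (klEngU₀9_le_klEngU₀4 P R cc).trans (klEngU₀4_le_inv_gfr_add_one P hR cc hj)

/-- **`klEngU₀10 P R cc ≤ 1/(R.Gfr j + 1)`** (`R.WF`, `j < 5`). -/
theorem klEngU₀10_le_inv_gfr_add_one (P : SplitConsts) {R : RenConsts} (hR : R.WF) (cc : ℝ) {j : ℕ} (hj : j < 5) :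
    klEngU₀10 P R cc ≤ 1 / (R.Gfr j + 1) :=
  (klEngU₀10_le_klEngU₀4 P R cc).trans (klEngU₀4_le_inv_gfr_add_one P hR cc hj)

/-- `klEngU₀10 P R cc ≤ 1/(|R.Gfr j| + 1)` (`j < 5`, sign-free). -/
theorem klEngU₀10_le_inv_abs_gfr_add_one (P : SplitConsts) (R : RenConsts) (cc : ℝ) {j : ℕ} (hj : j < 5) :
    klEngU₀10 P R cc ≤ 1 / (|R.Gfr j| + 1) :=
  (klEngU₀10_le_klEngU₀4 P R cc).trans (klEngU₀4_le_inv_abs_gfr_add_one P R cc hj)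

/-- **THE (R58)(b) ROW: `klEngU₀10 P R cc ≤ 1/(R.Gfr 3 + 1)`** (`R.WF`) — p3's W1 own door is below the registered v2 binder. -/
theorem klEngU₀10_le_inv_gfr3_add_one (P : SplitConsts) {R : RenConsts} (hR : R.WF) (cc : ℝ) :
    klEngU₀10 P R cc ≤ 1 / (R.Gfr 3 + 1) :=
  klEngU₀10_le_inv_gfr_add_one P hR cc (by norm_num)

/-- **The consumer line in p3's displayed shape** (`anisoTorusSumWt_flow`'s coupling binder): `R.WF → U ≤ klEngU₀10 P R c →
U ≤ min (klEngU₀3 P R c) (1/(R.Gfr 3 + 1))`. -/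
theorem le_min_klEngU₀3_inv_gfr3_of_le_klEngU₀10 {P : SplitConsts} {R : RenConsts} (hR : R.WF) {c U : ℝ} (hU : U ≤ klEngU₀10 P R c) :
    U ≤ min (klEngU₀3 P R c) (1 / (R.Gfr 3 + 1)) :=
  le_min (hU.trans (klEngU₀10_le_klEngU₀3 P R c)) (hU.trans (klEngU₀10_le_inv_gfr3_add_one P hR c))

/-- The same from `R.WF2` (the stubs' binder). -/
theorem le_min_klEngU₀3_inv_gfr3_of_le_klEngU₀10' {P : SplitConsts} {R : RenConsts} (hR : R.WF2) {c U : ℝ} (hU : U ≤ klEngU₀10 P R c) :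
    U ≤ min (klEngU₀3 P R c) (1 / (R.Gfr 3 + 1)) :=
  le_min_klEngU₀3_inv_gfr3_of_le_klEngU₀10 hR.1 hU

end Summit.HubbardSuperconductivity.HubbardSuperconductivity.Theorems.EngineV8

end
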